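import Summits.QuantumFields.BalabanUV.Beta.GAN24.WSlotParityBlind

/-!
# `BalabanUV.Beta.GAN24.WSlotParityJunction` — row G-an2-4, W-slot EXIT (α) «use the identity, not its defect» (summit-lead RULING R-lead-g77-1 (2); the OWNER
# gan24-p1 g33's RULING R-gan24p1-g33-1 (B3) «PARITY-JUNCTION»): **THE D1 END ASKS THE W-SLOT ROWS OF THE EVEN HALF ONLY** — the OWNER's `WSlotParityBlind`
# (the D1 consumer is blind to ANY localised row-parity-odd family `X`) INSTANTIATED AT `X_j :=` THE ODD HALF `½ • (W⁰_j − sgnK (trK W⁰_j))` of the W-table,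
# slice by slice; its two displayed rows `hX` (localised) and `hXt` (parity-odd) are DISCHARGED BY NAME for every second-order vertex family, so
# `exists_allScalesSeq_JsRecBmAtOf ∕ JsRowD1 ∕ JsRowD1Pin_of_slots_parity` become ENDs whose (hW, hWall) rows are asked of the EVEN HALF
# `½ • (W⁰_j + sgnK (trK W⁰_j))` ONLY — for an2's recursive block-mean family (`d = 3`) and for the literal of record `JsRowD1Pin`
# (G-an2-4 FORMAL swarm → CRUX TEAM (2), leaf-01 lineage `b2b-balaban-gan24-formalise-leaf-01`, gen 71).

NOT IN PRINT; OUR BOOKKEEPING.  HONEST FRAMING (cell contract, verbatim): «discharging `BetaPertH` makes Bałaban's UV stability UNCONDITIONAL — a real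
constructive-QFT result; it is NOT the continuum limit and NOT the Clay problem.»  HONEST DEPENDENCY (verbatim): «continuum YM on T⁴ ⇐ BetaPertH ∧ nine spine
estimates (0/9 proved); BetaPertH ⇐ (D1) ∧ (D4) ∧ CAP+tail; G-an2-4 gates asym, D1 and NE2/3/4.»  [folklore] composition BY NAME: the OWNER's
`WSlotParityBlind.{loc_of_vertexFamily₂, exists_allScalesSeq_JsRecBmAtOf_of_slots_parity}`, d1-leaf-06's `WardLocusParitySplit.parityOdd_oddHalf`, leaf-05's
`SpineRecursiveParity.loc_sgnK`, `TameKernelCalculus.Loc.{trK, sub, smul}`, an2's `SpineRooted.JsRecWAtOf_eq`, d1's `RowD1JointEnd.JsRowD1_eq ∕ JsRowD1Pin_eq`,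
road BF-x's `RoadEnd.d1Drift_iff_cesaro`.  No cited fact, no `def`, no `def … : Prop`, 0 sorry.  The S-slot rows and the EVEN-HALF W-slot rows stay
HYPOTHESES (row G-an2-4: «T2Shape^{ev}» ∧ «T2Drift^{ev}» — RULING R-gan24p1-g33-1 (C), an2 ∕ gan24-p2 — NOT in the tree); discharges NOTHING of (Q-R) ∕ (LT) ∕
(DIV) ∕ (DL) ∕ «T2Shape» ∕ «T2Drift» ∕ (hW, hWall); the record (β) of R-lead-g77-1 (the ODD half is not suppliable entrywise) is untouched — the consumer never reads
that half; NEVER «G-an2-4 closed» as (CONV-C); NOT D1, NOT BetaPertH, NOT continuum, NOT Clay.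

WHY.  The night's dictionary (gan24-p2 `WardResidualParity`, the OWNER `WardLawParitySplit` ∕ R29 ∕ R29-A1, three readings agreeing): the W-literal's Ward-locus
residual — the (Q-R) object and its divergent (DL) tower — is ROW-PARITY-ODD, and the EVEN half of the table obeys the EXACT block Ward identity.  The OWNER's
`WSlotParityBlind` proves the D1 END blind to any localised parity-odd `X`.  The junction typed here chooses `X :=` the odd half of the table itself, which is
parity-odd for free (`parityOdd_oddHalf`) and localised whenever the table is a vertex family — so NO property of the residual is needed to re-address the
consumer's rows to the even half: whatever the odd half carries (the whole (DL) tower, by the dictionary) is invisible to `secondMoment ∘ TbalOf`.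

* §1 (generic `d`) `loc_oddHalf`, **`loc_oddHalf_slice`** (`hX` discharged from `VertexFamily₂`), **`parityOdd_oddHalf_slice`** (`hXt`, hypothesis-free),
  **`sub_oddHalf_eq_evenHalf`** (`W − X = ½ • (W + sgnK∘trK∘W)`, entrywise `ring`).
* §2 (`d = 3`, in-block root, an2's `JsRecBmAtOf … W …`) **`exists_allScalesSeq_JsRecBmAtOf_of_slots_evenHalf`**: the OWNER's §2 END at `X := oddHalf ∘ W` —
  `∃ κ θ, 0 ≤ θ < 1 ∧ AllScalesSeq (j ↦ secondMoment (TbalOf Lc (JsRecBmAtOf … W …) j) μ ν) κ θ` ⟸ `hS hSall` + (hW, hWall) asked of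
  `unitW_j (½ • (W j + sgnK∘trK∘W j))` ONLY (no `X`-rows left).
* §3 the literal of record (odd `Lc ≥ 2`, centred root, pins): **`exists_allScalesSeq_JsRowD1_of_slots_evenHalf`**, **`exists_allScalesSeq_JsRowD1Pin_of_slots_evenHalf`**,
  `d1Drift_JsRowD1Pin_iff_cesaro_of_slots_evenHalf` — `RoadEndRowPinned`'s three ENDs with the W-slot rows on the EVEN HALF of `WrecAt 3 Lc ρ_c …`.
-/

open Finset Filter Topology
open scoped BigOperators
open Literature.MathematicalPhysics.QuantumFieldTheory
open Literature.MathematicalPhysics.QuantumFieldTheory.Balaban1983to89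
open Literature.MathematicalPhysics.QuantumFieldTheory.Balaban1983to89.Beta
open RemainderConstAllScales (AllScalesSeq)
open ExpKernelCalculus (MKer Decays BiLoc VertexFamily₂ hessKer tadpole)
open AffineAveraging (box toSite)
open AveragingContoursRooted (ctrOff ctrOff_mem_box)
open AveragingMixedJetTables (mixFFAt)
open OneStepResolventKernel (Fib LocStencil JetData)
open OneStepKernelFamily (vertexOfK KInvStep TbalOf D1Drift)
open WilsonVertex2Sym (wsym22)
open Summit.QuantumFields.BalabanUV.Beta.TameKernelCalculus (Loc trK)
open Summit.QuantumFields.BalabanUV.Beta.BorderedHessian (sgnK)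
open Summit.QuantumFields.BalabanUV.Beta.HessKerDressedUnits (unitK unitS unitW)
open Summit.QuantumFields.BalabanUV.Beta.AxialDressingRooted (coDressKBmAt)
open Summit.QuantumFields.BalabanUV.Beta.SpineRooted (JsRecBmAtOf JsRecWAtOf JsRecWAtOf_eq WrecAt)
open Summit.QuantumFields.BalabanUV.Beta.WardLocusRecursive (SrecAt)
open Summit.QuantumFields.BalabanUV.Beta.SecondOrderSocketIdentification (vh₂SAn1)
open Summit.QuantumFields.BalabanUV.Beta.RowD1JointEnd (JsRowD1 JsRowD1Pin JsRowD1_eq JsRowD1Pin_eq)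
open Summit.QuantumFields.BalabanUV.Beta.GAN24.CombesThomas (sfStep smStep)
open Summit.QuantumFields.BalabanUV.Beta.D1BFx.RoadEnd (d1Drift_iff_cesaro)
open Summit.QuantumFields.BalabanUV.Beta.SpineRecursiveParity (loc_sgnK)
open Summit.QuantumFields.BalabanUV.Beta.WardLocusParitySplit (parityOdd_oddHalf)
open Summit.QuantumFields.BalabanUV.Beta.GAN24.WSlotParityBlind (loc_of_vertexFamily₂ exists_allScalesSeq_JsRecBmAtOf_of_slots_parity)

namespace Summit.QuantumFields.BalabanUV.Beta.GAN24.WSlotParityJunction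

noncomputable section

/-! ## §1 Generic `d`: the odd half of a table is a legitimate blind family; the table minus it is the even half -/

section Generic

variable {d : ℕ}

/-- [folklore] The odd half `½ • (L − sgnK (trK L))` of a localised kernel is localised (`Loc.trK`, leaf-05's `loc_sgnK`, `Loc.sub`, `Loc.smul`). -/
theorem loc_oddHalf {L : MKer (d + 1) (Fib d)} (h : Loc L) : Loc (((1 : ℝ) / 2) • (L - sgnK (trK L))) :=
  (h.sub (loc_sgnK h.trK)).smul _

/-- [folklore] **`hX` DISCHARGED**: for a second-order vertex family `W` at a positive radius, every base-point slice of its ODD HALF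
`½ • (W μ 0 ν z − sgnK (trK (W μ 0 ν z)))` is localised (the OWNER's `loc_of_vertexFamily₂` ⨾ `loc_oddHalf`). -/
theorem loc_oddHalf_slice {W : Fin (d + 1) → (Fin (d + 1) → ℤ) → Fin (d + 1) → (Fin (d + 1) → ℤ) → MKer (d + 1) (Fib d)} {N : ℕ} {Cw δ : ℝ}
    (hW : VertexFamily₂ W N Cw δ) (hδ : 0 < δ) (μ ν : Fin (d + 1)) (z : Fin (d + 1) → ℤ) :
    Loc (((1 : ℝ) / 2) • (W μ 0 ν z - sgnK (trK (W μ 0 ν z)))) :=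
  loc_oddHalf (loc_of_vertexFamily₂ hW hδ μ 0 ν z)

/-- [folklore] **`hXt`, HYPOTHESIS-FREE**: every base-point slice of the odd half of ANY table family is row-parity-odd (d1-leaf-06's `parityOdd_oddHalf`). -/
theorem parityOdd_oddHalf_slice (W : Fin (d + 1) → (Fin (d + 1) → ℤ) → Fin (d + 1) → (Fin (d + 1) → ℤ) → MKer (d + 1) (Fib d))
    (μ ν : Fin (d + 1)) (z : Fin (d + 1) → ℤ) :
    trK (((1 : ℝ) / 2) • (W μ 0 ν z - sgnK (trK (W μ 0 ν z)))) = -sgnK (((1 : ℝ) / 2) • (W μ 0 ν z - sgnK (trK (W μ 0 ν z)))) :=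
  parityOdd_oddHalf _

/-- [folklore] **THE TABLE MINUS ITS ODD HALF IS ITS EVEN HALF**: `W − (μ z ν z′ ↦ ½ • (W μ z ν z′ − sgnK (trK (W μ z ν z′)))) = (μ z ν z′ ↦ ½ • (W μ z ν z′ + sgnK (trK (W μ z ν z′))))`
(entrywise `ring`). -/
theorem sub_oddHalf_eq_evenHalf (W : Fin (d + 1) → (Fin (d + 1) → ℤ) → Fin (d + 1) → (Fin (d + 1) → ℤ) → MKer (d + 1) (Fib d)) :
    (W - fun μ z ν z' => ((1 : ℝ) / 2) • (W μ z ν z' - sgnK (trK (W μ z ν z')))) =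
      fun μ z ν z' => ((1 : ℝ) / 2) • (W μ z ν z' + sgnK (trK (W μ z ν z'))) := by
  funext μ z ν z' x y a b
  simp only [Pi.sub_apply, Pi.smul_apply, Pi.add_apply, smul_eq_mul]
  ring

end Generic

/-! ## §2 `d = 3`: an2's recursive block-mean family — the all-scales END with the W-slot rows asked of the EVEN HALF only -/

section RecBm

variable {Lc : ℕ} [NeZero Lc] (hLc : 1 ≤ Lc) {r : Fin (3 + 1) → ℕ} (hr : r ∈ box (3 + 1) Lc) (cE cVH cΛ : ℝ)
  (W : ℕ → Fin (3 + 1) → (Fin (3 + 1) → ℤ) → Fin (3 + 1) → (Fin (3 + 1) → ℤ) → MKer (3 + 1) (Fib 3))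
  (Cw' δw : ℕ → ℝ) (hδw : ∀ j, 0 < δw j) (hW' : ∀ j, VertexFamily₂ (W j) Lc (Cw' j) (δw j))
  {Cs cS δS θS Cw cW δW θW : ℝ}

/-- NOT IN PRINT; OUR BOOKKEEPING.  **THE SCALAR ALL-SCALES BOUND OF THE STEP COEFFICIENTS OF an2's RECURSIVE BLOCK-MEAN FAMILY FROM THE S-SLOT ROWS AND THE
W-SLOT ROWS OF THE EVEN HALF ONLY** (`d = 3`, `2 ≤ Lc`, in-block root, adopted units `sfStep Lc` ∕ `smStep 3 Lc`): the OWNER's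
`WSlotParityBlind.exists_allScalesSeq_JsRecBmAtOf_of_slots_parity` at `X_j :=` the odd half of `W j` (slice by slice), whose two rows are discharged by §1 (`hX` from
the family's own `VertexFamily₂` certificate `hW′`, `hXt` hypothesis-free); hence `hW` ∕ `hWall` are asked of the EVEN-HALF tables
`unitW_j (½ • (W j + sgnK∘trK∘W j))` and NOTHING is asked of the odd half ⟹ `∃ κ θ, 0 ≤ θ < 1 ∧ AllScalesSeq (j ↦ secondMoment (TbalOf Lc (JsRecBmAtOf … W …) j) μ ν) κ θ`
for the UNMODIFIED family.  The S-∕even-W-rows are HYPOTHESES (row G-an2-4, RULING R-gan24p1-g33-1 (C): «T2Shape^{ev}» ∧ «T2Drift^{ev}», NOT in the tree). -/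
theorem exists_allScalesSeq_JsRecBmAtOf_of_slots_evenHalf (hLc2 : 2 ≤ Lc)
    (hS : ∀ j, LocStencil (unitS (sfStep Lc j) (smStep 3 Lc j) (SrecAt 3 Lc (toSite r) cE cVH cΛ j)) Cs δS)
    (hSall : ∀ k j, LocStencil (unitS (sfStep Lc (k + j)) (smStep 3 Lc (k + j)) (SrecAt 3 Lc (toSite r) cE cVH cΛ (k + j)) -
      unitS (sfStep Lc k) (smStep 3 Lc k) (SrecAt 3 Lc (toSite r) cE cVH cΛ k)) (cS * θS ^ k) δS)
    (hW : ∀ j, VertexFamily₂ (unitW (sfStep Lc j) (smStep 3 Lc j)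
      (fun μ z ν z' => ((1 : ℝ) / 2) • (W j μ z ν z' + sgnK (trK (W j μ z ν z'))))) Lc Cw δW)
    (hWall : ∀ k j, VertexFamily₂ (unitW (sfStep Lc (k + j)) (smStep 3 Lc (k + j))
        (fun μ z ν z' => ((1 : ℝ) / 2) • (W (k + j) μ z ν z' + sgnK (trK (W (k + j) μ z ν z')))) -
      unitW (sfStep Lc k) (smStep 3 Lc k) (fun μ z ν z' => ((1 : ℝ) / 2) • (W k μ z ν z' + sgnK (trK (W k μ z ν z'))))) Lc (cW * θW ^ k) δW)
    (hδS : 0 < δS) (hδW : 0 < δW) (hθS0 : 0 ≤ θS) (hθS1 : θS < 1) (hθW0 : 0 ≤ θW) (hθW1 : θW < 1) (μ ν : Fin 4) :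
    ∃ κ θ : ℝ, 0 ≤ θ ∧ θ < 1 ∧
      AllScalesSeq (fun j => B12Beta.secondMoment (TbalOf Lc (JsRecBmAtOf hLc hr cE cVH cΛ W Cw' δw hδw hW') j) μ ν) κ θ := by
  -- the OWNER's `hW` ∕ `hWall` rows on `W j − X j`, supplied from the even-half rows by §1's identity
  have hWX : ∀ j, VertexFamily₂ (unitW (sfStep Lc j) (smStep 3 Lc j)
      (W j - fun μ z ν z' => ((1 : ℝ) / 2) • (W j μ z ν z' - sgnK (trK (W j μ z ν z'))))) Lc Cw δW := fun j => by
    rw [sub_oddHalf_eq_evenHalf (W j)]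
    exact hW j
  have hWallX : ∀ k j, VertexFamily₂ (unitW (sfStep Lc (k + j)) (smStep 3 Lc (k + j))
        (W (k + j) - fun μ z ν z' => ((1 : ℝ) / 2) • (W (k + j) μ z ν z' - sgnK (trK (W (k + j) μ z ν z')))) -
      unitW (sfStep Lc k) (smStep 3 Lc k)
        (W k - fun μ z ν z' => ((1 : ℝ) / 2) • (W k μ z ν z' - sgnK (trK (W k μ z ν z'))))) Lc (cW * θW ^ k) δW := fun k j => by
    rw [sub_oddHalf_eq_evenHalf (W (k + j)), sub_oddHalf_eq_evenHalf (W k)]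
    exact hWall k j
  exact exists_allScalesSeq_JsRecBmAtOf_of_slots_parity hLc hr cE cVH cΛ W Cw' δw hδw hW'
    (fun j μ z ν z' => ((1 : ℝ) / 2) • (W j μ z ν z' - sgnK (trK (W j μ z ν z'))))
    (fun j μ ν z => loc_oddHalf_slice (hW' j) (hδw j) μ ν z) (fun j μ ν z => parityOdd_oddHalf_slice (W j) μ ν z)
    hLc2 hS hSall hWX hWallX hδS hδW hθS0 hθS1 hθW0 hθW1 μ ν

end RecBm

/-! ## §3 The literal of record: the `hall` supplier with the (E)-family W-slot rows asked of the EVEN HALF of `WrecAt` only -/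

section Record

variable {Lc : ℕ} [NeZero Lc] {Cs cS δS θS Cw cW δW θW : ℝ}

/-- NOT IN PRINT; OUR BOOKKEEPING.  **ROAD BF-x's `hall` ∕ `hθ0` ∕ `hθ1` BINDERS FOR THE LITERAL `JsRowD1 hLc N cΛ cB` FROM THE (E)-FAMILY S-SLOT ROWS AND THE W-SLOT ROWS
OF THE EVEN HALF OF `WrecAt 3 Lc ρ_c …` ONLY** (odd `Lc ≥ 2`, adopted units; §2 at the centred root after an2's `JsRecWAtOf_eq` — the odd half's `hX` comes from
`WrecAt`'s own certificate `WrecAt_loc₂`).  `RoadEndRowPinned.exists_allScalesSeq_JsRowD1_of_slots` asks the same rows of the WHOLE table; the OWNER's `…_parity`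
of the table minus any blind `X`; this one of the EVEN HALF.  The rows are HYPOTHESES (row G-an2-4, family (E): not in the tree). -/
theorem exists_allScalesSeq_JsRowD1_of_slots_evenHalf (hLc : Odd Lc) (hL2 : 2 ≤ Lc) (N : ℕ) (cΛ cB : ℝ)
    (hS : ∀ j, LocStencil (unitS (sfStep Lc j) (smStep 3 Lc j)
      (SrecAt 3 Lc (toSite (ctrOff (3 + 1) Lc)) ((Lc : ℝ) ^ 4) (-((Lc : ℝ) ^ 8 / 2)) cΛ j)) Cs δS)
    (hSall : ∀ k j, LocStencil (unitS (sfStep Lc (k + j)) (smStep 3 Lc (k + j))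
        (SrecAt 3 Lc (toSite (ctrOff (3 + 1) Lc)) ((Lc : ℝ) ^ 4) (-((Lc : ℝ) ^ 8 / 2)) cΛ (k + j)) -
      unitS (sfStep Lc k) (smStep 3 Lc k) (SrecAt 3 Lc (toSite (ctrOff (3 + 1) Lc)) ((Lc : ℝ) ^ 4) (-((Lc : ℝ) ^ 8 / 2)) cΛ k)) (cS * θS ^ k) δS)
    (hW : ∀ j, VertexFamily₂ (unitW (sfStep Lc j) (smStep 3 Lc j)
      (fun μ z ν z' => ((1 : ℝ) / 2) •
        (WrecAt 3 Lc (toSite (ctrOff (3 + 1) Lc)) ((Lc : ℝ) ^ 4) (-((Lc : ℝ) ^ 8 / 2)) cΛ ((Lc : ℝ) ^ 8) cB ((8 * (N : ℝ) ^ 2)⁻¹ • wsym22 N)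
            (vh₂SAn1 Lc) (mixFFAt (toSite (ctrOff (3 + 1) Lc)) Lc) j μ z ν z'
          + sgnK (trK (WrecAt 3 Lc (toSite (ctrOff (3 + 1) Lc)) ((Lc : ℝ) ^ 4) (-((Lc : ℝ) ^ 8 / 2)) cΛ ((Lc : ℝ) ^ 8) cB ((8 * (N : ℝ) ^ 2)⁻¹ • wsym22 N)
            (vh₂SAn1 Lc) (mixFFAt (toSite (ctrOff (3 + 1) Lc)) Lc) j μ z ν z'))))) Lc Cw δW)
    (hWall : ∀ k j, VertexFamily₂ (unitW (sfStep Lc (k + j)) (smStep 3 Lc (k + j))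
        (fun μ z ν z' => ((1 : ℝ) / 2) •
          (WrecAt 3 Lc (toSite (ctrOff (3 + 1) Lc)) ((Lc : ℝ) ^ 4) (-((Lc : ℝ) ^ 8 / 2)) cΛ ((Lc : ℝ) ^ 8) cB ((8 * (N : ℝ) ^ 2)⁻¹ • wsym22 N)
              (vh₂SAn1 Lc) (mixFFAt (toSite (ctrOff (3 + 1) Lc)) Lc) (k + j) μ z ν z'
            + sgnK (trK (WrecAt 3 Lc (toSite (ctrOff (3 + 1) Lc)) ((Lc : ℝ) ^ 4) (-((Lc : ℝ) ^ 8 / 2)) cΛ ((Lc : ℝ) ^ 8) cB ((8 * (N : ℝ) ^ 2)⁻¹ • wsym22 N)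
              (vh₂SAn1 Lc) (mixFFAt (toSite (ctrOff (3 + 1) Lc)) Lc) (k + j) μ z ν z')))) -
      unitW (sfStep Lc k) (smStep 3 Lc k)
        (fun μ z ν z' => ((1 : ℝ) / 2) •
          (WrecAt 3 Lc (toSite (ctrOff (3 + 1) Lc)) ((Lc : ℝ) ^ 4) (-((Lc : ℝ) ^ 8 / 2)) cΛ ((Lc : ℝ) ^ 8) cB ((8 * (N : ℝ) ^ 2)⁻¹ • wsym22 N)
              (vh₂SAn1 Lc) (mixFFAt (toSite (ctrOff (3 + 1) Lc)) Lc) k μ z ν z'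
            + sgnK (trK (WrecAt 3 Lc (toSite (ctrOff (3 + 1) Lc)) ((Lc : ℝ) ^ 4) (-((Lc : ℝ) ^ 8 / 2)) cΛ ((Lc : ℝ) ^ 8) cB ((8 * (N : ℝ) ^ 2)⁻¹ • wsym22 N)
              (vh₂SAn1 Lc) (mixFFAt (toSite (ctrOff (3 + 1) Lc)) Lc) k μ z ν z'))))) Lc (cW * θW ^ k) δW)
    (hδS : 0 < δS) (hδW : 0 < δW) (hθS0 : 0 ≤ θS) (hθS1 : θS < 1) (hθW0 : 0 ≤ θW) (hθW1 : θW < 1) (μ ν : Fin 4) :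
    ∃ κ θ : ℝ, 0 ≤ θ ∧ θ < 1 ∧ AllScalesSeq (fun j => B12Beta.secondMoment (TbalOf Lc (JsRowD1 hLc N cΛ cB) j) μ ν) κ θ := by
  rw [JsRowD1_eq, JsRecWAtOf_eq]
  exact exists_allScalesSeq_JsRecBmAtOf_of_slots_evenHalf hLc.pos (ctrOff_mem_box hLc.pos) _ _ _ _ _ _ _ _ hL2 hS hSall hW hWall
    hδS hδW hθS0 hθS1 hθW0 hθW1 μ ν

/-- NOT IN PRINT; OUR BOOKKEEPING.  **ROAD BF-x's `hall` ∕ `hθ0` ∕ `hθ1` BINDERS FOR THE LITERAL OF RECORD `JsRowD1Pin hLc N` WITH THE W-SLOT ROWS ASKED OF THE EVEN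
HALF OF `WrecAt` ONLY** (`cΛ := 2∕Lc⁴`, `cB := −Lc¹²∕4`; odd `Lc ≥ 2`): `∃ κ θ, 0 ≤ θ < 1 ∧ AllScalesSeq (j ↦ β⁰_j) κ θ`,
`β⁰_j := secondMoment (TbalOf Lc (JsRowD1Pin hLc N) j) μ ν` — CONDITIONAL on the two S-slot rows and the two EVEN-HALF W-slot rows («T2Shape^{ev}» ∧ «T2Drift^{ev}»). -/
theorem exists_allScalesSeq_JsRowD1Pin_of_slots_evenHalf (hLc : Odd Lc) (hL2 : 2 ≤ Lc) (N : ℕ)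
    (hS : ∀ j, LocStencil (unitS (sfStep Lc j) (smStep 3 Lc j)
      (SrecAt 3 Lc (toSite (ctrOff (3 + 1) Lc)) ((Lc : ℝ) ^ 4) (-((Lc : ℝ) ^ 8 / 2)) (2 / (Lc : ℝ) ^ 4) j)) Cs δS)
    (hSall : ∀ k j, LocStencil (unitS (sfStep Lc (k + j)) (smStep 3 Lc (k + j))
        (SrecAt 3 Lc (toSite (ctrOff (3 + 1) Lc)) ((Lc : ℝ) ^ 4) (-((Lc : ℝ) ^ 8 / 2)) (2 / (Lc : ℝ) ^ 4) (k + j)) -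
      unitS (sfStep Lc k) (smStep 3 Lc k)
        (SrecAt 3 Lc (toSite (ctrOff (3 + 1) Lc)) ((Lc : ℝ) ^ 4) (-((Lc : ℝ) ^ 8 / 2)) (2 / (Lc : ℝ) ^ 4) k)) (cS * θS ^ k) δS)
    (hW : ∀ j, VertexFamily₂ (unitW (sfStep Lc j) (smStep 3 Lc j)
      (fun μ z ν z' => ((1 : ℝ) / 2) •
        (WrecAt 3 Lc (toSite (ctrOff (3 + 1) Lc)) ((Lc : ℝ) ^ 4) (-((Lc : ℝ) ^ 8 / 2)) (2 / (Lc : ℝ) ^ 4) ((Lc : ℝ) ^ 8) (-((Lc : ℝ) ^ 12 / 4))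
            ((8 * (N : ℝ) ^ 2)⁻¹ • wsym22 N) (vh₂SAn1 Lc) (mixFFAt (toSite (ctrOff (3 + 1) Lc)) Lc) j μ z ν z'
          + sgnK (trK (WrecAt 3 Lc (toSite (ctrOff (3 + 1) Lc)) ((Lc : ℝ) ^ 4) (-((Lc : ℝ) ^ 8 / 2)) (2 / (Lc : ℝ) ^ 4) ((Lc : ℝ) ^ 8) (-((Lc : ℝ) ^ 12 / 4))
            ((8 * (N : ℝ) ^ 2)⁻¹ • wsym22 N) (vh₂SAn1 Lc) (mixFFAt (toSite (ctrOff (3 + 1) Lc)) Lc) j μ z ν z'))))) Lc Cw δW)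
    (hWall : ∀ k j, VertexFamily₂ (unitW (sfStep Lc (k + j)) (smStep 3 Lc (k + j))
        (fun μ z ν z' => ((1 : ℝ) / 2) •
          (WrecAt 3 Lc (toSite (ctrOff (3 + 1) Lc)) ((Lc : ℝ) ^ 4) (-((Lc : ℝ) ^ 8 / 2)) (2 / (Lc : ℝ) ^ 4) ((Lc : ℝ) ^ 8) (-((Lc : ℝ) ^ 12 / 4))
              ((8 * (N : ℝ) ^ 2)⁻¹ • wsym22 N) (vh₂SAn1 Lc) (mixFFAt (toSite (ctrOff (3 + 1) Lc)) Lc) (k + j) μ z ν z'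
            + sgnK (trK (WrecAt 3 Lc (toSite (ctrOff (3 + 1) Lc)) ((Lc : ℝ) ^ 4) (-((Lc : ℝ) ^ 8 / 2)) (2 / (Lc : ℝ) ^ 4) ((Lc : ℝ) ^ 8) (-((Lc : ℝ) ^ 12 / 4))
              ((8 * (N : ℝ) ^ 2)⁻¹ • wsym22 N) (vh₂SAn1 Lc) (mixFFAt (toSite (ctrOff (3 + 1) Lc)) Lc) (k + j) μ z ν z')))) -
      unitW (sfStep Lc k) (smStep 3 Lc k)
        (fun μ z ν z' => ((1 : ℝ) / 2) •
          (WrecAt 3 Lc (toSite (ctrOff (3 + 1) Lc)) ((Lc : ℝ) ^ 4) (-((Lc : ℝ) ^ 8 / 2)) (2 / (Lc : ℝ) ^ 4) ((Lc : ℝ) ^ 8) (-((Lc : ℝ) ^ 12 / 4))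
              ((8 * (N : ℝ) ^ 2)⁻¹ • wsym22 N) (vh₂SAn1 Lc) (mixFFAt (toSite (ctrOff (3 + 1) Lc)) Lc) k μ z ν z'
            + sgnK (trK (WrecAt 3 Lc (toSite (ctrOff (3 + 1) Lc)) ((Lc : ℝ) ^ 4) (-((Lc : ℝ) ^ 8 / 2)) (2 / (Lc : ℝ) ^ 4) ((Lc : ℝ) ^ 8) (-((Lc : ℝ) ^ 12 / 4))
              ((8 * (N : ℝ) ^ 2)⁻¹ • wsym22 N) (vh₂SAn1 Lc) (mixFFAt (toSite (ctrOff (3 + 1) Lc)) Lc) k μ z ν z'))))) Lc (cW * θW ^ k) δW)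
    (hδS : 0 < δS) (hδW : 0 < δW) (hθS0 : 0 ≤ θS) (hθS1 : θS < 1) (hθW0 : 0 ≤ θW) (hθW1 : θW < 1) (μ ν : Fin 4) :
    ∃ κ θ : ℝ, 0 ≤ θ ∧ θ < 1 ∧ AllScalesSeq (fun j => B12Beta.secondMoment (TbalOf Lc (JsRowD1Pin hLc N) j) μ ν) κ θ :=
  exists_allScalesSeq_JsRowD1_of_slots_evenHalf hLc hL2 N _ _ hS hSall hW hWall hδS hδW hθS0 hθS1 hθW0 hθW1 μ ν

/-- NOT IN PRINT; OUR BOOKKEEPING.  **FOR THE LITERAL OF RECORD THE WALL's TERM IS A CESÀRO STATEMENT ⟸ THE (E)-FAMILY S-SLOT ROWS ∧ THE EVEN-HALF W-SLOT ROWS**: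
every channel `(μ, ν)`, every colour parameter `Nc`: `D1Drift Lc (JsRowD1Pin hLc N) Nc μ ν ⟺ (Σ_{j<m} β⁰_j)∕m → stepBal Nc Lc` (road BF-x's `d1Drift_iff_cesaro` at the
`hall` above).  The even-half twin of `RoadEndRowPinned.d1Drift_JsRowD1Pin_iff_cesaro_of_slots` and of the OWNER's `…_of_slots_parity`. -/
theorem d1Drift_JsRowD1Pin_iff_cesaro_of_slots_evenHalf (hLc : Odd Lc) (hL2 : 2 ≤ Lc) (N : ℕ)
    (hS : ∀ j, LocStencil (unitS (sfStep Lc j) (smStep 3 Lc j)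
      (SrecAt 3 Lc (toSite (ctrOff (3 + 1) Lc)) ((Lc : ℝ) ^ 4) (-((Lc : ℝ) ^ 8 / 2)) (2 / (Lc : ℝ) ^ 4) j)) Cs δS)
    (hSall : ∀ k j, LocStencil (unitS (sfStep Lc (k + j)) (smStep 3 Lc (k + j))
        (SrecAt 3 Lc (toSite (ctrOff (3 + 1) Lc)) ((Lc : ℝ) ^ 4) (-((Lc : ℝ) ^ 8 / 2)) (2 / (Lc : ℝ) ^ 4) (k + j)) -
      unitS (sfStep Lc k) (smStep 3 Lc k)
        (SrecAt 3 Lc (toSite (ctrOff (3 + 1) Lc)) ((Lc : ℝ) ^ 4) (-((Lc : ℝ) ^ 8 / 2)) (2 / (Lc : ℝ) ^ 4) k)) (cS * θS ^ k) δS)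
    (hW : ∀ j, VertexFamily₂ (unitW (sfStep Lc j) (smStep 3 Lc j)
      (fun μ z ν z' => ((1 : ℝ) / 2) •
        (WrecAt 3 Lc (toSite (ctrOff (3 + 1) Lc)) ((Lc : ℝ) ^ 4) (-((Lc : ℝ) ^ 8 / 2)) (2 / (Lc : ℝ) ^ 4) ((Lc : ℝ) ^ 8) (-((Lc : ℝ) ^ 12 / 4))
            ((8 * (N : ℝ) ^ 2)⁻¹ • wsym22 N) (vh₂SAn1 Lc) (mixFFAt (toSite (ctrOff (3 + 1) Lc)) Lc) j μ z ν z'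
          + sgnK (trK (WrecAt 3 Lc (toSite (ctrOff (3 + 1) Lc)) ((Lc : ℝ) ^ 4) (-((Lc : ℝ) ^ 8 / 2)) (2 / (Lc : ℝ) ^ 4) ((Lc : ℝ) ^ 8) (-((Lc : ℝ) ^ 12 / 4))
            ((8 * (N : ℝ) ^ 2)⁻¹ • wsym22 N) (vh₂SAn1 Lc) (mixFFAt (toSite (ctrOff (3 + 1) Lc)) Lc) j μ z ν z'))))) Lc Cw δW)
    (hWall : ∀ k j, VertexFamily₂ (unitW (sfStep Lc (k + j)) (smStep 3 Lc (k + j))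
        (fun μ z ν z' => ((1 : ℝ) / 2) •
          (WrecAt 3 Lc (toSite (ctrOff (3 + 1) Lc)) ((Lc : ℝ) ^ 4) (-((Lc : ℝ) ^ 8 / 2)) (2 / (Lc : ℝ) ^ 4) ((Lc : ℝ) ^ 8) (-((Lc : ℝ) ^ 12 / 4))
              ((8 * (N : ℝ) ^ 2)⁻¹ • wsym22 N) (vh₂SAn1 Lc) (mixFFAt (toSite (ctrOff (3 + 1) Lc)) Lc) (k + j) μ z ν z'
            + sgnK (trK (WrecAt 3 Lc (toSite (ctrOff (3 + 1) Lc)) ((Lc : ℝ) ^ 4) (-((Lc : ℝ) ^ 8 / 2)) (2 / (Lc : ℝ) ^ 4) ((Lc : ℝ) ^ 8) (-((Lc : ℝ) ^ 12 / 4))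
              ((8 * (N : ℝ) ^ 2)⁻¹ • wsym22 N) (vh₂SAn1 Lc) (mixFFAt (toSite (ctrOff (3 + 1) Lc)) Lc) (k + j) μ z ν z')))) -
      unitW (sfStep Lc k) (smStep 3 Lc k)
        (fun μ z ν z' => ((1 : ℝ) / 2) •
          (WrecAt 3 Lc (toSite (ctrOff (3 + 1) Lc)) ((Lc : ℝ) ^ 4) (-((Lc : ℝ) ^ 8 / 2)) (2 / (Lc : ℝ) ^ 4) ((Lc : ℝ) ^ 8) (-((Lc : ℝ) ^ 12 / 4))
              ((8 * (N : ℝ) ^ 2)⁻¹ • wsym22 N) (vh₂SAn1 Lc) (mixFFAt (toSite (ctrOff (3 + 1) Lc)) Lc) k μ z ν z'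
            + sgnK (trK (WrecAt 3 Lc (toSite (ctrOff (3 + 1) Lc)) ((Lc : ℝ) ^ 4) (-((Lc : ℝ) ^ 8 / 2)) (2 / (Lc : ℝ) ^ 4) ((Lc : ℝ) ^ 8) (-((Lc : ℝ) ^ 12 / 4))
              ((8 * (N : ℝ) ^ 2)⁻¹ • wsym22 N) (vh₂SAn1 Lc) (mixFFAt (toSite (ctrOff (3 + 1) Lc)) Lc) k μ z ν z'))))) Lc (cW * θW ^ k) δW)
    (hδS : 0 < δS) (hδW : 0 < δW) (hθS0 : 0 ≤ θS) (hθS1 : θS < 1) (hθW0 : 0 ≤ θW) (hθW1 : θW < 1) (μ ν : Fin 4) (Nc : ℝ) :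
    D1Drift Lc (JsRowD1Pin hLc N) Nc μ ν ↔
      Tendsto (fun m : ℕ => (∑ j ∈ range m, B12Beta.secondMoment (TbalOf Lc (JsRowD1Pin hLc N) j) μ ν) / (m : ℝ)) atTop
        (𝓝 (B12Normalization.stepBal Nc Lc)) := by
  obtain ⟨κ, θ, hθ0, hθ1, hall⟩ := exists_allScalesSeq_JsRowD1Pin_of_slots_evenHalf hLc hL2 N hS hSall hW hWall hδS hδW hθS0 hθS1 hθW0 hθW1 μ ν
  exact d1Drift_iff_cesaro _ hall hθ0 hθ1 Nc

end Record

end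

end Summit.QuantumFields.BalabanUV.Beta.GAN24.WSlotParityJunction
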